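import Summits.BirchSwinnertonDyer.BirchSwinnertonDyer.Theorems.AlignedTransportAtTwoMainConjectureOfRankZeroBSDAtTwoCubicChevalleyLValueBit
import Summits.BirchSwinnertonDyer.BirchSwinnertonDyer.Theorems.AlignedTransportAtTwoMainConjectureOfRankZeroBSDAtTwoCubicKilfordPrimes
import Summits.BirchSwinnertonDyer.BirchSwinnertonDyer.Theorems.AlignedTransportAtTwoOffStratumPartitionTwistFamilySmallSeeds
import Summits.BirchSwinnertonDyer.Rank1Residual.Additive.IntModelTamagawaCertificate
import Literature.NumberTheory.EllipticCurves.ComplexMultiplicationTwistIsogenyProofs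
import Literature.NumberTheory.EllipticCurves.ComplexMultiplicationRationalJIntegralProofs
import HarnessLib

/-!
# Route `AlignedTransportAtTwo`, crux C2 `MainConjectureOfRankZeroBSDAtTwo` (stmt-BirchSwinnertonDyer-22298):
# THE SMALLEST-CONDUCTOR ROW OF THE CUBIC CHEVALLEY ROAD — `MC₂(139a1)` from PRINT + ONE `L`-VALUE BIT, every other binder kernel-decided

HONEST FRAMING (cell `bsd-f1-sign2`, WIDTH-5 attached prover seat `bsd-line-att-p5` gen 31 on line `birth` of the lead `bsd-line-att-p2`;
`--supports` stmt-BirchSwinnertonDyer-22298, closes nothing; BSD is NOT proved by any of this; the crux C2, its verdict «blocked-on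
`Rank1Residual.GreenbergMuConjectureIrreducible`» and every registered stub are untouched). THEOREMS ONLY (no definition, no instance,
no named fact, no `sorry`); the curve is written LITERALLY throughout, exactly as in the sister file `…CubicChevalleyRow307b1`.

THE SEED. Cremona's `139A1 = [1, 1, 0, −3, −4]`, `y² + xy = x³ + x² − 3x − 4`: `N = 139` (prime), `Δ_min = −139 ≡ 5 (mod 8)` (OFF the Kilford
stratum; `2` is unramified in `ℚ(β)`), `a₂ = +1` (good ORDINARY), `E(ℚ)_tors = 0`, `E[2]` irreducible (the `u`-cubic `u³ + 5u² − 48u − 256`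
has no root mod `5`), `c₁₃₉ = 1` (`I₁`, split: nodal root `20`), rank `0` (Cremona 1992 Table 1, `139 A1`), `L(E,1)/Ω = 1` (`w = +1`,
`L(1) = Ω = 1.7396869770` re-computed on the seat by the AGM period and the `L`-series). Its cubic `2`-torsion field `ℚ(β)` (discriminant
`−139`) has the norm-`+1` unit `η = (144 + u − 3u²)/16`, `u = 4β`, `η³ − 4η² + 6η − 1 = 0`, and under `u ↦ e` (the odd `2`-adic root,
`e ≡ 11 (mod 128)`) `η ↦ −208/16 = −13 ≡ 3 (mod 8)`: `2`-adic sign `−1`, the door FIRES. This is the smallest conductor on which the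
g28–g31 `(0,1)` unit-sign door fires (the g31 census of the firing set `{Δ_min ≡ 5 (8)} ∩ {odd L/Ω} ∩ {σ₁(η) ≡ 3 (8)}` begins
`139, 307, 1763, 2515, 3115, 3371, 3547, 4771, 4883, 5443, 5579, …`; crux workfile `ODD-BRANCH-att-p5-g31.md` §7).

WHAT. §1 kernel-decided curve data (`Δ`, `c₄`, ellipticity, minimality, `N = 139`, `#Ẽ(𝔽₂) = 2`, `E[2]` irreducible, `Δ_min ≡ 5 (8)`,
`Δ < 0`, Tate row certificate `⟨139, 11, 1, 20, …, c = 1⟩` ⟹ `∏ c_v` odd, non-CM); §2 `BSD(139a1, 2)` from Creutz–Miller (`N < 5000`);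
§3 the unit certificate (`linear_combination`; `128 ∣ c_W(11)`; `P(11) ≡ 2⁴·3 (mod 2⁷)`); §4 ★ `mazurMainConjecture_two_139a1_of_lValue`
(+ `_eq_one`) and `classicalMuVanishes_cubicField_139a1_of_lValue` — att-p5 g30's doors with every other binder discharged in the kernel.

CONDITIONAL theorems (PRINT⁵, Creutz–Miller, `hYY`, MuIneqʳ and two certificates `r_an = 0`, `L/Ω` odd displayed); nothing is closed;
BSD is not proved; beyond-print theorem: no.

References: [CremonaAlgorithms1997] Table 1 (`139 A`); [CreutzMiller2012] Thm. 1.1; [YooYu2022] Thm. 1.6 with 1.4 / 1.10 / 1.11 (1), Lemma 4.11;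
[Kato2004Asterisque] Thm. 17.4; [GreenbergLNM1716] Thm. 4.1; [Miller2011LMS] Def. 1.1; [SilvermanAEC2009] III.1, VII.1, VII.5; [Silverman1994] IV.9.4, IV.10.2;
[Serre1973] II §3.3; tree: att-p5 g29 `…CubicChevalleyUnitSign(Doors)`, g30 `…SelmerTwoOfBSDp` / `…CubicChevalleyLValueBit`, g31 `…CubicChevalleyRow307b1`,
att-p4 `…TwistFamilySmallSeeds`, b2b `Rank2ObservatoryTamagawa*` / `IntModelTamagawaCertificate`.
-/

set_option linter.dupNamespace false
set_option autoImplicit false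

noncomputable section

open scoped Classical NumberField nonZeroDivisors IntermediateField

namespace Summit.BirchSwinnertonDyer.BirchSwinnertonDyer.Theorems.AlignedTransportAtTwoCubicChevalleyRow139a1

open NumberField IsDedekindDomain Polynomial WeierstrassCurve IntermediateField CongruenceSubgroup
  Literature.NumberTheory.IwasawaTheory Literature.NumberTheory.GaloisRepresentations
  Literature.NumberTheory.EllipticCurves Literature.NumberTheory.EllipticCurves.Greenberg1999
  Literature.NumberTheory.EllipticCurves.ModularForms Literature.NumberTheory.EllipticCurves.Rank1Residual
  Literature.NumberTheory.EllipticCurves.Module Literature.NumberTheory.EllipticCurves.Zhai2016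
  Summit.BirchSwinnertonDyer.Rank1Residual Summit.BirchSwinnertonDyer.Rank1Residual.X1.MuLambda
  Summit.BirchSwinnertonDyer.Rank1Residual.X5 Summit.BirchSwinnertonDyer.Rank1Residual.X5.O1
  Summit.BirchSwinnertonDyer.Rank1Residual.X5.Instances Summit.BirchSwinnertonDyer.Rank1Residual.F1Sign2
  Summit.BirchSwinnertonDyer.BirchSwinnertonDyer.Theorems.Rank1ResidualX1Defs
  Summit.BirchSwinnertonDyer.BirchSwinnertonDyer.Theses.AlignedTransportAtTwo
  Summit.BirchSwinnertonDyer.BirchSwinnertonDyer.Rank2Observatory.Tam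
  Summit.BirchSwinnertonDyer.Rank1Residual.Additive.IntModelTam
  Summit.BirchSwinnertonDyer.BirchSwinnertonDyer.Theorems.AlignedTransportAtTwoCubicChevalleyLValueBit
  Summit.BirchSwinnertonDyer.BirchSwinnertonDyer.Theorems.AlignedTransportAtTwoSelmerTwoOfBSDp
open Summit.BirchSwinnertonDyer.BirchSwinnertonDyer.Theorems.AlignedTransportAtTwoCubicKilfordPrimes (psi_gen_eq_zero)
open Summit.BirchSwinnertonDyer.BirchSwinnertonDyer.Theorems.AlignedTransportAtTwoKilfordStratumShared
  (not_onKilfordStratumAtTwo_iff_minimalDiscriminantInt_emod_eight_ne)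

/-! ## §1 The curve `139a1 = [1, 1, 0, 0, −1]` — kernel-decided invariants -/

/-- `Δ(139a1) = −139` (minus a prime). [cite: CremonaAlgorithms1997, Table 1] -/
theorem M139a1_Δ : (⟨1, 1, 0, -3, -4⟩ : WeierstrassCurve ℤ).Δ = -139 := by decide

/-- `c₄(139a1) = 169`. [cite: CremonaAlgorithms1997, Table 1] -/
theorem M139a1_c₄ : (⟨1, 1, 0, -3, -4⟩ : WeierstrassCurve ℤ).c₄ = 169 := by decide

/-- `139a1` is an elliptic curve (`Δ = −139 ≠ 0`). [cite: CremonaAlgorithms1997, Table 1] -/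
theorem isElliptic_139a1 : ((⟨1, 1, 0, -3, -4⟩ : WeierstrassCurve ℤ).baseChange ℚ).IsElliptic := by
  rw [WeierstrassCurve.isElliptic_iff, baseChange_int_Δ, M139a1_Δ]; norm_num

/-- Cremona's model `139a1` is globally minimal (`gcd(Δ, c₄) = 1`). [cite: SilvermanAEC2009, VII.1 Remark 1.1] -/
theorem isGloballyMinimal_139a1 : ((⟨1, 1, 0, -3, -4⟩ : WeierstrassCurve ℤ).baseChange ℚ).IsGloballyMinimal :=
  isGloballyMinimal_baseChange_int_of_gcd_eq_one 1 1 0 (-3) (-4) (by decide)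

/-- `Δ(139a1)` and `c₄(139a1)` are coprime (semistable model). [cite: SilvermanAEC2009, VII.5 Prop. 5.1 (b)] -/
theorem M139a1_coprime : IsCoprime (⟨1, 1, 0, -3, -4⟩ : WeierstrassCurve ℤ).Δ (⟨1, 1, 0, -3, -4⟩ : WeierstrassCurve ℤ).c₄ := by
  rw [M139a1_Δ, M139a1_c₄, Int.isCoprime_iff_gcd_eq_one]; decide

/-- **`N(139a1) = 139`** (semistable: `N = rad Δ`). [cite: Silverman1994, IV.10.2 (a),(b)] [cite: CremonaAlgorithms1997, Table 1] -/
theorem conductorNorm_139a1 [((⟨1, 1, 0, -3, -4⟩ : WeierstrassCurve ℤ).baseChange ℚ).IsElliptic] :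
    ((⟨1, 1, 0, -3, -4⟩ : WeierstrassCurve ℤ).baseChange ℚ).conductorNorm ℤ = 139 := by
  refine conductorNorm_baseChange_int_of_isCoprime (⟨1, 1, 0, -3, -4⟩ : WeierstrassCurve ℤ) M139a1_coprime (k := 1) ?_ ?_ ?_
  · exact (show Nat.Prime 139 by norm_num).prime.squarefree
  · rw [M139a1_Δ]; norm_num
  · rw [M139a1_Δ]; norm_num

/-- `139a1 mod 2` is `y² + xy = x³ + x² + x`. [folklore] -/
theorem M139a1_mod_two : (⟨1, 1, 0, -3, -4⟩ : WeierstrassCurve ℤ).map (Int.castRingHom (ZMod 2)) = ⟨1, 1, 0, 1, 0⟩ := by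
  ext <;> decide

/-- `#Ẽ(𝔽₂) = 2` for `139a1` (points `O`, `(0,0)`): `a₂ = 3 − 2 = +1`. [cite: CremonaAlgorithms1997, Table 3] -/
theorem M139a1_card_two :
    Nat.card ((⟨1, 1, 0, -3, -4⟩ : WeierstrassCurve ℤ).map (Int.castRingHom (ZMod 2))).toAffine.Point = 2 := by
  rw [M139a1_mod_two, natCard_point_eq_one_add_card _ (by decide)]; decide

/-- **`139a1` has good ORDINARY reduction at `2`** (`2 ∤ Δ`, `#Ẽ(𝔽₂) = 2`). [cite: SilvermanAEC2009, VII.5 Prop. 5.1 (a)] -/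
theorem goodOrd_two_139a1 [((⟨1, 1, 0, -3, -4⟩ : WeierstrassCurve ℤ).baseChange ℚ).IsElliptic]
    [((⟨1, 1, 0, -3, -4⟩ : WeierstrassCurve ℤ).baseChange ℚ).IsGloballyMinimal] :
    GoodOrd ((⟨1, 1, 0, -3, -4⟩ : WeierstrassCurve ℤ).baseChange ℚ) 2 :=
  goodOrd_two_baseChange_int_of_card_two _ (by rw [M139a1_Δ]; decide) M139a1_card_two

/-- The coefficients of `139a1 / ℚ` (unfolded). [cite: CremonaAlgorithms1997, Table 1] -/
theorem c139a1_eq : (⟨1, 1, 0, -3, -4⟩ : WeierstrassCurve ℤ).baseChange ℚ = ⟨1, 1, 0, -3, -4⟩ := by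
  rw [baseChange_int_eq]; norm_num

/-- `b₂, b₄, b₆` of `139a1`: `5, −6, −16`. [cite: SilvermanAEC2009, III.1] -/
theorem c139a1_b : ((⟨1, 1, 0, -3, -4⟩ : WeierstrassCurve ℤ).baseChange ℚ).b₂ = ((5 : ℤ) : ℚ) ∧
    ((⟨1, 1, 0, -3, -4⟩ : WeierstrassCurve ℤ).baseChange ℚ).b₄ = ((-6 : ℤ) : ℚ) ∧
    ((⟨1, 1, 0, -3, -4⟩ : WeierstrassCurve ℤ).baseChange ℚ).b₆ = ((-16 : ℤ) : ℚ) := by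
  rw [c139a1_eq]; simp only [WeierstrassCurve.b₂, WeierstrassCurve.b₄, WeierstrassCurve.b₆]; norm_num

/-- **`E[2]` irreducible for `139a1`**: the monic `u`-cubic `u³ + 5u² − 48u − 256` has no root modulo `5`.
[cite: SilvermanAEC2009, III.2.3 (b)] -/
theorem irr_two_139a1 [((⟨1, 1, 0, -3, -4⟩ : WeierstrassCurve ℤ).baseChange ℚ).IsElliptic] :
    Irr ((⟨1, 1, 0, -3, -4⟩ : WeierstrassCurve ℤ).baseChange ℚ) 2 :=
  irr_two_of_forall_cubic_ne _ c139a1_b.1 c139a1_b.2.1 c139a1_b.2.2 (ℓ := 5) (by decide)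

/-- No rational `2`-torsion abscissa on `139a1` (the route's `ht` binder). [cite: SilvermanAEC2009, III.2.3 (b)] -/
theorem not_hasRationalTwoTorsionX_139a1 [((⟨1, 1, 0, -3, -4⟩ : WeierstrassCurve ℤ).baseChange ℚ).IsElliptic] :
    ∀ x : ℚ, ¬ HasRationalTwoTorsionX ((⟨1, 1, 0, -3, -4⟩ : WeierstrassCurve ℤ).baseChange ℚ) x := by
  intro x hx
  exact (O1.irr_two_iff_not_exists_addOrderOf_eq_two _).mp irr_two_139a1 (exists_point_addOrderOf_eq_two hx)

/-- `Δ_min(139a1) = −139`. [cite: CremonaAlgorithms1997, Table 1] -/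
theorem minimalDiscriminantInt_139a1 [((⟨1, 1, 0, -3, -4⟩ : WeierstrassCurve ℤ).baseChange ℚ).IsGloballyMinimal] :
    ((⟨1, 1, 0, -3, -4⟩ : WeierstrassCurve ℤ).baseChange ℚ).minimalDiscriminantInt = -139 := by
  rw [Instances.minimalDiscriminantInt_baseChange_int, M139a1_Δ]

/-- **`139a1` is OFF the Kilford stratum** (`Δ_min ≡ 5 ≢ 1 (mod 8)`; good ordinary at `2`). [cite: Serre1973, Ch. II §3.3 Thm. 4] -/
theorem not_onKilfordStratumAtTwo_139a1 [((⟨1, 1, 0, -3, -4⟩ : WeierstrassCurve ℤ).baseChange ℚ).IsElliptic]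
    [((⟨1, 1, 0, -3, -4⟩ : WeierstrassCurve ℤ).baseChange ℚ).IsGloballyMinimal] :
    ¬ OnKilfordStratumAtTwo ((⟨1, 1, 0, -3, -4⟩ : WeierstrassCurve ℤ).baseChange ℚ) :=
  (not_onKilfordStratumAtTwo_iff_minimalDiscriminantInt_emod_eight_ne _ goodOrd_two_139a1).mpr
    (by rw [minimalDiscriminantInt_139a1]; decide)

/-- `Δ(139a1) < 0` (one real root of the `2`-division cubic). [cite: CremonaAlgorithms1997, Table 1] -/
theorem Δ_139a1_neg : ((⟨1, 1, 0, -3, -4⟩ : WeierstrassCurve ℤ).baseChange ℚ).Δ < 0 := by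
  rw [baseChange_int_Δ, M139a1_Δ]; norm_num

/-- Tate's algorithm ROW CERTIFICATE of `139a1`: the one bad prime `139` (`⌊√139⌋ = 11`) is SPLIT multiplicative of type `I₁`
(node-tangent root `w = 20`), `c₁₃₉ = 1`. [cite: Silverman1994, IV.9.4 Step 2] [cite: CremonaAlgorithms1997, Table 1] -/
theorem tamRowCheck_139a1 :
    TamLocal.rowCheck [⟨139, 11, 1, 20, 0, 0, 0, 1, 0, 0, 1⟩] (⟨1, 1, 0, -3, -4⟩ : WeierstrassCurve ℤ) = true := by
  decide +kernel

/-- **`2 ∤ ∏ c_ℓ(139a1)`** (indeed `∏ c_ℓ = c₁₃₉ = 1`), from the row certificate. [cite: Silverman1994, IV.9.4 Step 2] -/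
theorem not_two_dvd_tamagawaProduct_139a1 [((⟨1, 1, 0, -3, -4⟩ : WeierstrassCurve ℤ).baseChange ℚ).IsGloballyMinimal] :
    ¬ 2 ∣ ((⟨1, 1, 0, -3, -4⟩ : WeierstrassCurve ℤ).baseChange ℚ).tamagawaProduct :=
  not_dvd_tamagawaProduct_of_intModel_of_rowCheck
    (Literature.NumberTheory.EllipticCurves.integralModelInt_baseChange_int (⟨1, 1, 0, -3, -4⟩ : WeierstrassCurve ℤ))
    tamRowCheck_139a1 2 (by decide)

/-- **`∏ c_ℓ(139a1)` is odd** (the door's `htam` binder). [cite: Silverman1994, IV.9.4 Step 2] -/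
theorem odd_tamagawaProduct_139a1 [((⟨1, 1, 0, -3, -4⟩ : WeierstrassCurve ℤ).baseChange ℚ).IsGloballyMinimal] :
    Odd ((⟨1, 1, 0, -3, -4⟩ : WeierstrassCurve ℤ).baseChange ℚ).tamagawaProduct :=
  Nat.odd_iff.mpr (Nat.two_dvd_ne_zero.mp not_two_dvd_tamagawaProduct_139a1)

/-- **`139a1` has no complex multiplication**: `j = 169³/(−139)` is not an integer. [cite: SilvermanAEC2009, App. C §11] -/
theorem not_hasCM_139a1 [((⟨1, 1, 0, -3, -4⟩ : WeierstrassCurve ℤ).baseChange ℚ).IsElliptic] :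
    ¬ ((⟨1, 1, 0, -3, -4⟩ : WeierstrassCurve ℤ).baseChange ℚ).HasCM := fun hCM ↦ by
  obtain ⟨n, hn⟩ := ((⟨1, 1, 0, -3, -4⟩ : WeierstrassCurve ℤ).baseChange ℚ).exists_intCast_eq_j_of_hasCM hCM
  rw [j_eq_c₄_pow_div, baseChange_int_c₄, baseChange_int_Δ, M139a1_c₄, M139a1_Δ] at hn
  have h : (n : ℚ) * (-139) = 169 ^ 3 := by
    rw [hn]; push_cast; field_simp
  have h' : n * (-139) = 169 ^ 3 := by exact_mod_cast h
  omega

/-! ## §2 `BSD(139a1, 2)` from Creutz–Miller 2012 Thm. 1.1 (`N = 139 < 5000`, rank `= r_an = 0`) -/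

/-- **`BSD(139a1, 2)`** modulo PRINT {Creutz–Miller 2012 Thm. 1.1 (`hCM`), GZK (`hGZK`)} + the certificate `r_an(139a1) = 0`.
[cite: CreutzMiller2012, Thm. 1.1] [cite: Miller2011LMS, Def. 1.1] -/
theorem bsdp_two_139a1_of_creutzMiller [((⟨1, 1, 0, -3, -4⟩ : WeierstrassCurve ℤ).baseChange ℚ).IsElliptic]
    [((⟨1, 1, 0, -3, -4⟩ : WeierstrassCurve ℤ).baseChange ℚ).IsGloballyMinimal]
    (hCM : bsdTriple_of_rank_le_one_of_conductor_lt) (hGZK : rank_eq_analyticRank_of_analyticRank_le_one)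
    (hr : ((⟨1, 1, 0, -3, -4⟩ : WeierstrassCurve ℤ).baseChange ℚ).analyticRank = 0) :
    BSDp ((⟨1, 1, 0, -3, -4⟩ : WeierstrassCurve ℤ).baseChange ℚ) 2 :=
  forall_bsdp_of_bsdTriple _ (tamagawaProduct_pos_holds _)
    (hCM _ (by rw [(hGZK _ (by omega)).1]; omega) (by rw [conductorNorm_139a1]; norm_num)) 2 Nat.prime_two

/-! ## §3 The unit certificate of `ℚ(β)` (discriminant `−139`): `η = (144 + u − 3u²)/16`, `u = 4β` -/

/-- **The cubic unit equation in `ℚ(β)`**: with `P = 144 + X − 3X²`, `k = 4`, `m = 1`, the element `η = P(4β)/16` satisfies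
`η³ − 4η² + 6η − 1 = 0` (so `η ∈ (𝓞ℚ(β))ˣ`, norm `+1`) — one `linear_combination` against `ψ_W(β) = 4β³ + 5β² − 12β − 16 = 0`
with multiplier `−(27/4)β³ + (81/8)β² + (1197/64)β − 229/8`. [cite: SilvermanAEC2009, III.1] [cite: Lang1990, Ch. 13 §4] -/
theorem unit_eq_139a1 {β : AlgebraicClosure ℚ}
    (hβ : aeval β ((⟨1, 1, 0, -3, -4⟩ : WeierstrassCurve ℤ).baseChange ℚ).twoTorsionPolynomial.toPoly = 0) :
    (aeval (4 * (AdjoinSimple.gen ℚ β : ↥(IntermediateField.adjoin ℚ ({β} : Set (AlgebraicClosure ℚ)))))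
          (((144 + X - 3 * X ^ 2 : ℤ[X])).map (Int.castRingHom ℚ)) /
          (2 ^ (4 : ℕ) * ((1 : ℤ) : ↥(IntermediateField.adjoin ℚ ({β} : Set (AlgebraicClosure ℚ)))))) ^ 3
        - ((4 : ℤ) : ↥(IntermediateField.adjoin ℚ ({β} : Set (AlgebraicClosure ℚ)))) *
          (aeval (4 * (AdjoinSimple.gen ℚ β : ↥(IntermediateField.adjoin ℚ ({β} : Set (AlgebraicClosure ℚ)))))
          (((144 + X - 3 * X ^ 2 : ℤ[X])).map (Int.castRingHom ℚ)) /
          (2 ^ (4 : ℕ) * ((1 : ℤ) : ↥(IntermediateField.adjoin ℚ ({β} : Set (AlgebraicClosure ℚ)))))) ^ 2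
        + ((6 : ℤ) : ↥(IntermediateField.adjoin ℚ ({β} : Set (AlgebraicClosure ℚ)))) *
          (aeval (4 * (AdjoinSimple.gen ℚ β : ↥(IntermediateField.adjoin ℚ ({β} : Set (AlgebraicClosure ℚ)))))
          (((144 + X - 3 * X ^ 2 : ℤ[X])).map (Int.castRingHom ℚ)) /
          (2 ^ (4 : ℕ) * ((1 : ℤ) : ↥(IntermediateField.adjoin ℚ ({β} : Set (AlgebraicClosure ℚ))))))
        - ((1 : ℤ) : ↥(IntermediateField.adjoin ℚ ({β} : Set (AlgebraicClosure ℚ)))) = 0 := by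
  have hψ := psi_gen_eq_zero ((⟨1, 1, 0, -3, -4⟩ : WeierstrassCurve ℤ).baseChange ℚ) hβ
  rw [c139a1_b.1, c139a1_b.2.1, c139a1_b.2.2] at hψ
  set g : ↥(IntermediateField.adjoin ℚ ({β} : Set (AlgebraicClosure ℚ))) := AdjoinSimple.gen ℚ β with hg
  simp only [Polynomial.map_add, Polynomial.map_sub, Polynomial.map_pow, Polynomial.map_mul, Polynomial.map_X,
    Polynomial.map_ofNat, map_add, map_sub, map_pow, map_mul, aeval_X, map_ofNat] at hψ ⊢
  push_cast at hψ ⊢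
  linear_combination ((-27 / 4 : ↥(IntermediateField.adjoin ℚ ({β} : Set (AlgebraicClosure ℚ)))) * g ^ 3
    + (81 / 8 : ↥(IntermediateField.adjoin ℚ ({β} : Set (AlgebraicClosure ℚ)))) * g ^ 2
    + (1197 / 64 : ↥(IntermediateField.adjoin ℚ ({β} : Set (AlgebraicClosure ℚ)))) * g - 229 / 8) * hψ

/-- `128 ∣ c_W(11)` for the `u`-cubic `c_W = u³ + 5u² − 48u − 256` of `139a1` (`c_W(11) = 1152 = 2⁷·9`): `e ≡ 11 (mod 128)` for the
odd `2`-adic root `e`. [cite: Serre1973, Ch. II §2.2] -/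
theorem cubic_dvd_139a1 [((⟨1, 1, 0, -3, -4⟩ : WeierstrassCurve ℤ).baseChange ℚ).IsGloballyMinimal] :
    (2 : ℤ) ^ (4 + 3) ∣ (11 : ℤ) ^ 3
      + (integralModelInt ((⟨1, 1, 0, -3, -4⟩ : WeierstrassCurve ℤ).baseChange ℚ)).b₂ * 11 ^ 2
      + 8 * (integralModelInt ((⟨1, 1, 0, -3, -4⟩ : WeierstrassCurve ℤ).baseChange ℚ)).b₄ * 11
      + 16 * (integralModelInt ((⟨1, 1, 0, -3, -4⟩ : WeierstrassCurve ℤ).baseChange ℚ)).b₆ := by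
  rw [Literature.NumberTheory.EllipticCurves.integralModelInt_baseChange_int]
  decide

/-- The sign congruence `P(11)·1 = −208 ≡ 2⁴·3 (mod 2⁷)` (`σ(η) ≡ −13 ≡ 3 (mod 8)`: the Hilbert symbol `(σ(η), 2)₂ = −1`). [cite: Serre1973, Ch. III §1.2 Thm. 1] -/
theorem signCert_139a1 :
    ((((144 + X - 3 * X ^ 2 : ℤ[X])).eval 11 * 1 : ℤ) : ZMod (2 ^ (4 + 3))) = ((2 ^ 4 * 3 : ℤ) : ZMod (2 ^ (4 + 3))) := by
  simp only [eval_add, eval_sub, eval_pow, eval_mul, eval_ofNat, eval_X]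
  decide

/-! ## §4 THE ROW: `MC₂(139a1)` from PRINT + Creutz–Miller + `hYY` + MuIneqʳ + `r_an = 0` + one `L`-value bit -/

/-- **THE SMALLEST-CONDUCTOR ROW OF THE CUBIC CHEVALLEY ROAD — `MazurMainConjecture 139a1 2`.** Displayed: PRINT⁵ {`h17` Kato 17.4 (1)(2)
at `2` for `139a1`, `hGr` Greenberg 4.1, `hper` period unit, `hmod` modularity, `hGZK`} + `hCM` Creutz–Miller 2012 (gives `BSD(139a1,2)`) + `hYY`
(Brumer–Kramer / Yoo–Yu) + `hI` = MuIneqʳ (the registered stub of line `birth`, VERBATIM) + the certificate `r_an(139a1) = 0` + ONE datum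
«`L(139a1,1)/Ω = q` with `q ≠ 0`, `ord₂ q = 0`» (Cremona 1992 Table 1 `139 A1`: `r = 0`, `|T| = 1`, `c₁₃₉ = 1`; `L(1) = Ω = 1.7396869770`,
`q = 1`, re-computed on the seat). Every other binder of att-p5 g30's door
`…CubicChevalleyLValueBit.mazurMainConjecture_two_of_muIneqRel_of_lValue_unit_of_unitCerts_muFree` — ellipticity, minimality, good ordinary
reduction at `2`, no rational `2`-torsion abscissa, `Δ < 0`, off the Kilford stratum, `∏ c_v` odd, a root `β ∈ ℚ̄` of the `2`-division cubic,
the unit `η = (144 + 4β − 3(4β)²)/16` with its cubic equation (`T = 4`, `S = 6`, `sgn = +1`) and the `2`-adic certificate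
(`a = 11`, `c = 3`, `128 ∣ c_W(11)`, `P(11) ≡ 48 (mod 128)`) — is decided by the kernel. CONDITIONAL; BSD is NOT proved; nothing closed.
[cite: CremonaAlgorithms1997, Table 1 (139 A)] [cite: CreutzMiller2012, Thm. 1.1] [cite: YooYu2022, Thm. 1.6 with Thm. 1.10 and 1.11]
[cite: Kato2004Asterisque, Thm. 17.4 (1)(2) (p. 273)] [cite: GreenbergLNM1716, Thm. 4.1 (p. 102)] [cite: Miller2011LMS, Def. 1.1]
[cite: Fukuda1994, Thm. 1 (1), p. 264] [cite: Lang1990, Ch. 13 §4, Lemma 4.1] [cite: Serre1973, Ch. III §1.2 Thm. 1] -/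
theorem mazurMainConjecture_two_139a1_of_lValue
    [((⟨1, 1, 0, -3, -4⟩ : WeierstrassCurve ℤ).baseChange ℚ).IsElliptic] [((⟨1, 1, 0, -3, -4⟩ : WeierstrassCurve ℤ).baseChange ℚ).IsGloballyMinimal]
    (h17 : ∀ [NeZero (((⟨1, 1, 0, -3, -4⟩ : WeierstrassCurve ℤ).baseChange ℚ).conductorNorm ℤ)]
      (f : CuspForm (Gamma0 (((⟨1, 1, 0, -3, -4⟩ : WeierstrassCurve ℤ).baseChange ℚ).conductorNorm ℤ)) 2),
      kato_divisibility_allPrimes ((⟨1, 1, 0, -3, -4⟩ : WeierstrassCurve ℤ).baseChange ℚ) 2 (f := f))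
    (hGr : Greenberg1999.thm41_charValue_rankZero_anyPrime)
    (hper : realPeriodRat_eq_unit_mul_plusPeriod_two) (hmod : nonempty_modularParametrizationData)
    (hGZK : rank_eq_analyticRank_of_analyticRank_le_one)
    (hCM : bsdTriple_of_rank_le_one_of_conductor_lt)
    (hYY : yooYu_selmerTwo_eq_bot_oddClassNumber_cubicTwoTorsionField)
    (hI : ∀ (W : WeierstrassCurve ℚ) [W.IsElliptic] [W.IsGloballyMinimal], IsOrdinaryAt W 2 →
      (∀ x : ℚ, ¬ HasRationalTwoTorsionX W x) →
      ∀ (κ : ZpExtension ℚ 2) (γ : Field.absoluteGaloisGroup ℚ), κ.IsCyclotomic →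
      κ.IsTopGenerator γ → IsCyclotomicVariable 2 γ →
      ∀ ⦃N : ℕ⦄ [NeZero N] (f : CuspForm (Gamma0 N) 2), IsNewformOf W f →
      ∀ Gp : IwasawaAlgebra 2, iwasawaToPowerSeries 2 Gp = padicLFunction f (unitRoot W 2 : ℚ_[2]) →
      ∀ (D : W.SelmerDualData κ γ) (Yr : W.FineSelmerDualDataRelaxedInf κ γ),
        lengthAt (IwasawaAlgebra 2) D.X ⟨IwasawaAlgebra.augIdealP 2, IwasawaAlgebra.isPrime_augIdealP_holds 2⟩ ≤
          lengthAt (IwasawaAlgebra 2) (IwasawaAlgebra 2 ⧸ Ideal.span {Gp})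
              ⟨IwasawaAlgebra.augIdealP 2, IwasawaAlgebra.isPrime_augIdealP_holds 2⟩ +
            lengthAt (IwasawaAlgebra 2) Yr.X ⟨IwasawaAlgebra.augIdealP 2, IwasawaAlgebra.isPrime_augIdealP_holds 2⟩)
    (hr : ((⟨1, 1, 0, -3, -4⟩ : WeierstrassCurve ℤ).baseChange ℚ).analyticRank = 0)
    {q : ℚ} (hq0 : q ≠ 0) (hq : padicValRat 2 q = 0)
    (hL : ((⟨1, 1, 0, -3, -4⟩ : WeierstrassCurve ℤ).baseChange ℚ).entireLFunction 1 /
      ((((⟨1, 1, 0, -3, -4⟩ : WeierstrassCurve ℤ).baseChange ℚ).realPeriodRat : ℂ)) = (q : ℂ)) :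
    MazurMainConjecture ((⟨1, 1, 0, -3, -4⟩ : WeierstrassCurve ℤ).baseChange ℚ) 2 := by
  -- a root `β ∈ ℚ̄` of the `2`-division cubic `4x³ + 5x² − 12x − 16`
  have hdeg : ((⟨1, 1, 0, -3, -4⟩ : WeierstrassCurve ℤ).baseChange ℚ).twoTorsionPolynomial.toPoly.degree ≠ 0 := by
    rw [Cubic.degree_of_a_ne_zero (by simp [WeierstrassCurve.twoTorsionPolynomial])]; decide
  obtain ⟨β, hβ⟩ := IsAlgClosed.exists_aeval_eq_zero (AlgebraicClosure ℚ) _ hdeg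
  have hord : IsOrdinaryAt ((⟨1, 1, 0, -3, -4⟩ : WeierstrassCurve ℤ).baseChange ℚ) 2 := goodOrd_two_139a1
  exact mazurMainConjecture_two_of_muIneqRel_of_lValue_unit_of_unitCerts_muFree _ h17 hGr hper hmod hGZK hYY hI hord
    not_hasRationalTwoTorsionX_139a1 Δ_139a1_neg hr (bsdp_two_139a1_of_creutzMiller hCM hGZK hr) not_onKilfordStratumAtTwo_139a1
    odd_tamagawaProduct_139a1 ⟨q, hq0, hL, hq⟩ hβ (144 + X - 3 * X ^ 2) 4 1 1 11 3 4 6 1 (Or.inl rfl) (unit_eq_139a1 hβ)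
    (Or.inl rfl) ⟨5, by norm_num⟩ cubic_dvd_139a1 (by decide) signCert_139a1

/-- **THE ROW WITH THE VALUE `L(139a1,1)/Ω = 1`** (Cremona 1992 Table 1 `139 A1`: `r = 0`, `|T| = 1`, `c₁₃₉ = 1`, so BSD predicts `L/Ω = #Ш`;
numerically `w = +1`, `L(1) = Ω = 1.7396869770`). [cite: CremonaAlgorithms1997, Table 1 (139 A)] [cite: CreutzMiller2012, Thm. 1.1]
[cite: YooYu2022, Thm. 1.6 with Thm. 1.10 and 1.11] [cite: Kato2004Asterisque, Thm. 17.4 (1)(2) (p. 273)] [cite: GreenbergLNM1716, Thm. 4.1 (p. 102)]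
[cite: Miller2011LMS, Def. 1.1] -/
theorem mazurMainConjecture_two_139a1_of_lValue_eq_one
    [((⟨1, 1, 0, -3, -4⟩ : WeierstrassCurve ℤ).baseChange ℚ).IsElliptic] [((⟨1, 1, 0, -3, -4⟩ : WeierstrassCurve ℤ).baseChange ℚ).IsGloballyMinimal]
    (h17 : ∀ [NeZero (((⟨1, 1, 0, -3, -4⟩ : WeierstrassCurve ℤ).baseChange ℚ).conductorNorm ℤ)]
      (f : CuspForm (Gamma0 (((⟨1, 1, 0, -3, -4⟩ : WeierstrassCurve ℤ).baseChange ℚ).conductorNorm ℤ)) 2),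
      kato_divisibility_allPrimes ((⟨1, 1, 0, -3, -4⟩ : WeierstrassCurve ℤ).baseChange ℚ) 2 (f := f))
    (hGr : Greenberg1999.thm41_charValue_rankZero_anyPrime)
    (hper : realPeriodRat_eq_unit_mul_plusPeriod_two) (hmod : nonempty_modularParametrizationData)
    (hGZK : rank_eq_analyticRank_of_analyticRank_le_one)
    (hCM : bsdTriple_of_rank_le_one_of_conductor_lt)
    (hYY : yooYu_selmerTwo_eq_bot_oddClassNumber_cubicTwoTorsionField)
    (hI : ∀ (W : WeierstrassCurve ℚ) [W.IsElliptic] [W.IsGloballyMinimal], IsOrdinaryAt W 2 →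
      (∀ x : ℚ, ¬ HasRationalTwoTorsionX W x) →
      ∀ (κ : ZpExtension ℚ 2) (γ : Field.absoluteGaloisGroup ℚ), κ.IsCyclotomic →
      κ.IsTopGenerator γ → IsCyclotomicVariable 2 γ →
      ∀ ⦃N : ℕ⦄ [NeZero N] (f : CuspForm (Gamma0 N) 2), IsNewformOf W f →
      ∀ Gp : IwasawaAlgebra 2, iwasawaToPowerSeries 2 Gp = padicLFunction f (unitRoot W 2 : ℚ_[2]) →
      ∀ (D : W.SelmerDualData κ γ) (Yr : W.FineSelmerDualDataRelaxedInf κ γ),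
        lengthAt (IwasawaAlgebra 2) D.X ⟨IwasawaAlgebra.augIdealP 2, IwasawaAlgebra.isPrime_augIdealP_holds 2⟩ ≤
          lengthAt (IwasawaAlgebra 2) (IwasawaAlgebra 2 ⧸ Ideal.span {Gp})
              ⟨IwasawaAlgebra.augIdealP 2, IwasawaAlgebra.isPrime_augIdealP_holds 2⟩ +
            lengthAt (IwasawaAlgebra 2) Yr.X ⟨IwasawaAlgebra.augIdealP 2, IwasawaAlgebra.isPrime_augIdealP_holds 2⟩)
    (hr : ((⟨1, 1, 0, -3, -4⟩ : WeierstrassCurve ℤ).baseChange ℚ).analyticRank = 0)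
    (hL1 : ((⟨1, 1, 0, -3, -4⟩ : WeierstrassCurve ℤ).baseChange ℚ).entireLFunction 1 /
      ((((⟨1, 1, 0, -3, -4⟩ : WeierstrassCurve ℤ).baseChange ℚ).realPeriodRat : ℂ)) = ((1 : ℚ) : ℂ)) :
    MazurMainConjecture ((⟨1, 1, 0, -3, -4⟩ : WeierstrassCurve ℤ).baseChange ℚ) 2 :=
  mazurMainConjecture_two_139a1_of_lValue h17 hGr hper hmod hGZK hCM hYY hI hr one_ne_zero (by simp) hL1

/-- **`μ₂ = 0` for the cyclotomic `ℤ₂`-extension of the cubic field of discriminant `−139`** (`= ℚ(β)`, `β` any root of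
`4x³ + 5x² − 12x − 16` in `ℚ̄`), modulo `hYY` + Creutz–Miller + GZK + `r_an(139a1) = 0` + the datum «`L(139a1,1)/Ω = q`, `q ≠ 0`, `ord₂ q = 0`»:
att-p5 g30's `classicalMuVanishes_adjoin_of_lValue_unit_of_unitCerts_of_not_onKilfordStratumAtTwo` with every other binder kernel-decided.
[cite: YooYu2022, Thm. 1.6 with Thm. 1.10 and 1.11] [cite: CreutzMiller2012, Thm. 1.1] [cite: Fukuda1994, Thm. 1 (1), p. 264]
[cite: Lang1990, Ch. 13 §4, Lemma 4.1] [cite: Serre1973, Ch. III §1.2 Thm. 1] -/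
theorem classicalMuVanishes_cubicField_139a1_of_lValue
    (hYY : yooYu_selmerTwo_eq_bot_oddClassNumber_cubicTwoTorsionField)
    [((⟨1, 1, 0, -3, -4⟩ : WeierstrassCurve ℤ).baseChange ℚ).IsElliptic] [((⟨1, 1, 0, -3, -4⟩ : WeierstrassCurve ℤ).baseChange ℚ).IsGloballyMinimal]
    (hCM : bsdTriple_of_rank_le_one_of_conductor_lt) (hGZK : rank_eq_analyticRank_of_analyticRank_le_one)
    (hr : ((⟨1, 1, 0, -3, -4⟩ : WeierstrassCurve ℤ).baseChange ℚ).analyticRank = 0)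
    {q : ℚ} (hq0 : q ≠ 0) (hq : padicValRat 2 q = 0)
    (hL : ((⟨1, 1, 0, -3, -4⟩ : WeierstrassCurve ℤ).baseChange ℚ).entireLFunction 1 /
      ((((⟨1, 1, 0, -3, -4⟩ : WeierstrassCurve ℤ).baseChange ℚ).realPeriodRat : ℂ)) = (q : ℂ))
    {β : AlgebraicClosure ℚ}
    (hβ : aeval β ((⟨1, 1, 0, -3, -4⟩ : WeierstrassCurve ℤ).baseChange ℚ).twoTorsionPolynomial.toPoly = 0)
    (κP : ZpExtension ↥(IntermediateField.adjoin ℚ ({β} : Set (AlgebraicClosure ℚ))) 2) (hκP : κP.IsCyclotomic) :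
    ClassicalMuVanishes κP := by
  have hord : IsOrdinaryAt ((⟨1, 1, 0, -3, -4⟩ : WeierstrassCurve ℤ).baseChange ℚ) 2 := goodOrd_two_139a1
  exact classicalMuVanishes_adjoin_of_lValue_unit_of_unitCerts_of_not_onKilfordStratumAtTwo _ hYY hord
    not_hasRationalTwoTorsionX_139a1 Δ_139a1_neg not_onKilfordStratumAtTwo_139a1 odd_tamagawaProduct_139a1 hr
    (bsdp_two_139a1_of_creutzMiller hCM hGZK hr) ⟨q, hq0, hL, hq⟩ hβ (144 + X - 3 * X ^ 2) 4 1 1 11 3 4 6 1 (Or.inl rfl)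
    (unit_eq_139a1 hβ) (Or.inl rfl) ⟨5, by norm_num⟩ cubic_dvd_139a1 (by decide) signCert_139a1 κP hκP

end Summit.BirchSwinnertonDyer.BirchSwinnertonDyer.Theorems.AlignedTransportAtTwoCubicChevalleyRow139a1

end
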